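import Mathlib

/-!
# SoloBlind — certification of a matrix inverse from a floating-point approximate inverse
(ENGINE-L-SPEC §15(m): the PHASE-SCAN `pscan.theta_phase`)

Let `A` be a square complex matrix, `X` an approximate inverse and `R := 1 - X * A` its residual.
* `det_ne_zero_of_residual_rows`: if every row sum of `‖R i k‖` is `< 1` then `det A ≠ 0`
  (row diagonal dominance of `X * A`, via Mathlib's Gershgorin lemma).
* `entry_bound_of_fixed_point`: if `M = X + R * M` (which `M = A⁻¹` satisfies) and the row sums of
  `‖R i k‖` are `≤ ρ < 1`, then for every column `j` with `‖X k j‖ ≤ x j` for all `k`: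
  `‖M i j‖ ≤ ‖X i j‖ + ρ * x j / (1 - ρ)`.
* `inv_fixed_point`: `A⁻¹ = X + (1 - X * A) * A⁻¹` when `det A` is a unit.
These are exactly the inequalities the phase scan evaluates (with outward rounding) to enclose
`M(a,b) = (1 - a Ñ_c - b B̃_c)⁻¹` over a phase cell.
-/

namespace Summit.AnomalousDissipation.SoloBlind.ApproxInverse

open Matrix Finset

variable {n : Type*} [Fintype n] [DecidableEq n]

/-- The inverse is a fixed point of `M ↦ X + (1 - X A) M`. -/
theorem inv_fixed_point (A X : Matrix n n ℂ) (hA : IsUnit A.det) :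
    A⁻¹ = X + (1 - X * A) * A⁻¹ := by
  rw [Matrix.sub_mul, Matrix.one_mul, Matrix.mul_assoc, Matrix.mul_nonsing_inv _ hA, Matrix.mul_one]
  abel

/-- Residual row sums `< 1` make `X * A` row-diagonally dominant, hence `det A ≠ 0`. -/
theorem det_ne_zero_of_residual_rows (A X : Matrix n n ℂ)
    (h : ∀ i, ∑ k, ‖(1 - X * A) i k‖ < 1) : A.det ≠ 0 := by
  have hB : (X * A).det ≠ 0 := by
    apply det_ne_zero_of_sum_row_lt_diag
    intro k
    have hk := h k
    have hsplit : ∑ j, ‖(1 - X * A) k j‖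
        = ‖(1 - X * A) k k‖ + ∑ j ∈ Finset.univ.erase k, ‖(1 - X * A) k j‖ := by
      rw [← Finset.add_sum_erase _ _ (Finset.mem_univ k)]
    have hoff : ∑ j ∈ Finset.univ.erase k, ‖(1 - X * A) k j‖
        = ∑ j ∈ Finset.univ.erase k, ‖(X * A) k j‖ := by
      apply Finset.sum_congr rfl
      intro j hj
      have hne : j ≠ k := Finset.ne_of_mem_erase hj
      simp [Matrix.sub_apply, hne.symm]
    have hdiag : (1 - X * A) k k = 1 - (X * A) k k := by simp [Matrix.sub_apply]
    rw [hsplit, hoff, hdiag] at hk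
    have htri : 1 - ‖(X * A) k k‖ ≤ ‖1 - (X * A) k k‖ := by
      have := norm_sub_norm_le (1 : ℂ) ((X * A) k k)
      simpa using this
    linarith
  rw [Matrix.det_mul] at hB
  exact right_ne_zero_of_mul hB

omit [DecidableEq n] in
/-- Column-wise entry bound from the fixed-point identity `M = X + R M` with `‖R‖_∞ ≤ ρ < 1`. -/
theorem entry_bound_of_fixed_point [Nonempty n] (M X R : Matrix n n ℂ) (ρ : ℝ)
    (hM : M = X + R * M) (hR : ∀ i, ∑ k, ‖R i k‖ ≤ ρ) (hρ : ρ < 1)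
    (j : n) (x : ℝ) (hx : ∀ k, ‖X k j‖ ≤ x) :
    ∀ i, ‖M i j‖ ≤ ‖X i j‖ + ρ * x / (1 - ρ) := by
  -- column maximum C of |M k j|
  set C : ℝ := Finset.univ.sup' Finset.univ_nonempty (fun k => ‖M k j‖) with hC
  have hCk : ∀ k, ‖M k j‖ ≤ C := fun k => Finset.le_sup' (fun k => ‖M k j‖) (Finset.mem_univ k)
  have hρ0 : 0 ≤ ρ := by
    obtain ⟨i⟩ := ‹Nonempty n›
    exact le_trans (Finset.sum_nonneg (fun k _ => norm_nonneg _)) (hR i)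
  -- every entry: |M i j| ≤ |X i j| + ρ C
  have hrow : ∀ i, ‖M i j‖ ≤ ‖X i j‖ + ρ * C := by
    intro i
    have hij : M i j = X i j + ∑ k, R i k * M k j := by
      have := congrArg (fun T => T i j) hM
      simpa [Matrix.add_apply, Matrix.mul_apply] using this
    calc ‖M i j‖ = ‖X i j + ∑ k, R i k * M k j‖ := by rw [hij]
      _ ≤ ‖X i j‖ + ‖∑ k, R i k * M k j‖ := norm_add_le _ _
      _ ≤ ‖X i j‖ + ∑ k, ‖R i k * M k j‖ := by gcongr; exact norm_sum_le _ _
      _ = ‖X i j‖ + ∑ k, ‖R i k‖ * ‖M k j‖ := by simp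
      _ ≤ ‖X i j‖ + ∑ k, ‖R i k‖ * C := by
          gcongr with k hk
          exact hCk k
      _ = ‖X i j‖ + (∑ k, ‖R i k‖) * C := by rw [Finset.sum_mul]
      _ ≤ ‖X i j‖ + ρ * C := by
          have hC0 : 0 ≤ C := by
            obtain ⟨i0⟩ := ‹Nonempty n›
            exact le_trans (norm_nonneg _) (hCk i0)
          gcongr
          exact hR i
  -- hence C ≤ x + ρ C, i.e. C ≤ x / (1 - ρ)
  have hCle : C ≤ x + ρ * C := by
    obtain ⟨k0, _, hk0⟩ := Finset.exists_mem_eq_sup' Finset.univ_nonempty (fun k => ‖M k j‖)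
    have hCeq : C = ‖M k0 j‖ := by rw [hC]; exact hk0
    calc C = ‖M k0 j‖ := hCeq
      _ ≤ ‖X k0 j‖ + ρ * C := hrow k0
      _ ≤ x + ρ * C := by gcongr; exact hx k0
  have hCx : C ≤ x / (1 - ρ) := by
    rw [le_div_iff₀ (by linarith)]
    nlinarith
  intro i
  calc ‖M i j‖ ≤ ‖X i j‖ + ρ * C := hrow i
    _ ≤ ‖X i j‖ + ρ * (x / (1 - ρ)) := by gcongr
    _ = ‖X i j‖ + ρ * x / (1 - ρ) := by ring

omit [DecidableEq n] in
/-- Operator-norm form: the weighted row sums of `|M|` are at most `‖X‖ / (1 - ρ)` — stated for the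
plain row-sum norm: if `∑_k ‖X i k‖ ≤ ξ` for all `i` then `∑_k ‖M i k‖ ≤ ξ / (1 - ρ)` for all `i`. -/
theorem rowsum_bound_of_fixed_point [Nonempty n] (M X R : Matrix n n ℂ) (ρ ξ : ℝ)
    (hM : M = X + R * M) (hR : ∀ i, ∑ k, ‖R i k‖ ≤ ρ) (hρ : ρ < 1)
    (hX : ∀ i, ∑ k, ‖X i k‖ ≤ ξ) :
    ∀ i, ∑ k, ‖M i k‖ ≤ ξ / (1 - ρ) := by
  set C : ℝ := Finset.univ.sup' Finset.univ_nonempty (fun i => ∑ k, ‖M i k‖) with hC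
  have hCi : ∀ i, ∑ k, ‖M i k‖ ≤ C := fun i => Finset.le_sup' (fun i => ∑ k, ‖M i k‖) (Finset.mem_univ i)
  have hC0 : 0 ≤ C := by
    obtain ⟨i0⟩ := ‹Nonempty n›
    exact le_trans (Finset.sum_nonneg (fun k _ => norm_nonneg _)) (hCi i0)
  have hrow : ∀ i, ∑ k, ‖M i k‖ ≤ ξ + ρ * C := by
    intro i
    have hik : ∀ k, M i k = X i k + ∑ l, R i l * M l k := by
      intro k
      have := congrArg (fun T => T i k) hM
      simpa [Matrix.add_apply, Matrix.mul_apply] using this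
    calc ∑ k, ‖M i k‖ = ∑ k, ‖X i k + ∑ l, R i l * M l k‖ := by
            apply Finset.sum_congr rfl; intro k _; rw [hik k]
      _ ≤ ∑ k, (‖X i k‖ + ∑ l, ‖R i l‖ * ‖M l k‖) := by
            gcongr with k hk
            calc ‖X i k + ∑ l, R i l * M l k‖ ≤ ‖X i k‖ + ‖∑ l, R i l * M l k‖ := norm_add_le _ _
              _ ≤ ‖X i k‖ + ∑ l, ‖R i l * M l k‖ := by gcongr; exact norm_sum_le _ _
              _ = ‖X i k‖ + ∑ l, ‖R i l‖ * ‖M l k‖ := by simp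
      _ = ∑ k, ‖X i k‖ + ∑ l, ‖R i l‖ * ∑ k, ‖M l k‖ := by
            rw [Finset.sum_add_distrib, Finset.sum_comm]
            congr 1
            apply Finset.sum_congr rfl; intro l _; rw [Finset.mul_sum]
      _ ≤ ξ + ∑ l, ‖R i l‖ * C := by
            gcongr with l hl
            · exact hX i
            · exact hCi l
      _ = ξ + (∑ l, ‖R i l‖) * C := by rw [Finset.sum_mul]
      _ ≤ ξ + ρ * C := by gcongr; exact hR i
  have hCle : C ≤ ξ + ρ * C := by
    obtain ⟨i0, _, hi0⟩ := Finset.exists_mem_eq_sup' Finset.univ_nonempty (fun i => ∑ k, ‖M i k‖)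
    have hCeq : C = ∑ k, ‖M i0 k‖ := by rw [hC]; exact hi0
    calc C = ∑ k, ‖M i0 k‖ := hCeq
      _ ≤ ξ + ρ * C := hrow i0
  have hCx : C ≤ ξ / (1 - ρ) := by
    rw [le_div_iff₀ (by linarith)]
    nlinarith
  intro i
  exact le_trans (hCi i) hCx

end Summit.AnomalousDissipation.SoloBlind.ApproxInverse
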